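import Mathlib
import Summits.Ventures.PercRepro2.Defs
import Summits.Ventures.PercRepro2.Harris
import Summits.Ventures.PercRepro2.CoinDefs

/-!
# The five-coin cylinder partition (blind cell PercRepro2, night-2 g8; proofs/NIGHT2-DARC.md §33)

`prob_eq_sum_cyl5` / `prob_cyl5`: the five-coin versions of `prob_eq_sum_cyl4` / `prob_cyl4`
(CoinSquareCoreDefs.lean), for cores with five coins.
-/

namespace Summit.Ventures.PercRepro2.Coin

open Classical

section Cyl5

variable {E : Type*} [Fintype E] [DecidableEq E] {R : Type*} [Field R] {c₁ c₂ c₃ c₄ c₅ : E}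

/-- Any probability is the sum over the `32` cylinders of five distinct coins. -/
lemma prob_eq_sum_cyl5 (p : E → R) (A : Set (Config E)) :
    prob p A = ∑ b : Bool × Bool × Bool × Bool × Bool,
      prob p (A ∩ {ω | ω c₁ = b.1 ∧ ω c₂ = b.2.1 ∧ ω c₃ = b.2.2.1 ∧ ω c₄ = b.2.2.2.1 ∧
        ω c₅ = b.2.2.2.2}) := by
  unfold prob
  rw [Finset.sum_comm]
  refine Finset.sum_congr rfl fun ω _ => ?_
  rw [Finset.sum_eq_single (ω c₁, ω c₂, ω c₃, ω c₄, ω c₅)]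
  · by_cases hA : ω ∈ A
    · have hmem : ω ∈ A ∩ {ω' : Config E | ω' c₁ = (ω c₁, ω c₂, ω c₃, ω c₄, ω c₅).1 ∧
          ω' c₂ = (ω c₁, ω c₂, ω c₃, ω c₄, ω c₅).2.1 ∧ ω' c₃ = (ω c₁, ω c₂, ω c₃, ω c₄, ω c₅).2.2.1 ∧
          ω' c₄ = (ω c₁, ω c₂, ω c₃, ω c₄, ω c₅).2.2.2.1 ∧
          ω' c₅ = (ω c₁, ω c₂, ω c₃, ω c₄, ω c₅).2.2.2.2} := ⟨hA, rfl, rfl, rfl, rfl, rfl⟩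
      rw [Set.indicator_of_mem hA, Set.indicator_of_mem hmem]
    · rw [Set.indicator_of_notMem hA, Set.indicator_of_notMem (fun h' => hA h'.1)]
  · intro b _ hb
    rw [Set.indicator_of_notMem]
    rintro ⟨_, h1, h2, h3, h4, h5⟩
    apply hb
    obtain ⟨b₁, b₂, b₃, b₄, b₅⟩ := b
    simp only at h1 h2 h3 h4 h5
    rw [h1, h2, h3, h4, h5]
  · intro h; exact absurd (Finset.mem_univ _) h

/-- The probability of a five-coin cylinder (distinct coins). -/
lemma prob_cyl5 (p : E → R) (h12 : c₁ ≠ c₂) (h13 : c₁ ≠ c₃) (h14 : c₁ ≠ c₄) (h15 : c₁ ≠ c₅)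
    (h23 : c₂ ≠ c₃) (h24 : c₂ ≠ c₄) (h25 : c₂ ≠ c₅) (h34 : c₃ ≠ c₄) (h35 : c₃ ≠ c₅) (h45 : c₄ ≠ c₅)
    (b : Bool × Bool × Bool × Bool × Bool) :
    prob p {ω | ω c₁ = b.1 ∧ ω c₂ = b.2.1 ∧ ω c₃ = b.2.2.1 ∧ ω c₄ = b.2.2.2.1 ∧ ω c₅ = b.2.2.2.2} =
      edgeFactor (p c₁) b.1 * edgeFactor (p c₂) b.2.1 * edgeFactor (p c₃) b.2.2.1 *
        edgeFactor (p c₄) b.2.2.2.1 * edgeFactor (p c₅) b.2.2.2.2 := by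
  obtain ⟨b₁, b₂, b₃, b₄, b₅⟩ := b
  set σ : Config E := fun e => if e = c₁ then b₁ else if e = c₂ then b₂ else if e = c₃ then b₃
    else if e = c₄ then b₄ else if e = c₅ then b₅ else false with hσ
  have hset : {ω : Config E | ω c₁ = b₁ ∧ ω c₂ = b₂ ∧ ω c₃ = b₃ ∧ ω c₄ = b₄ ∧ ω c₅ = b₅} =
      cylinder {c₁, c₂, c₃, c₄, c₅} σ := by
    ext ω
    simp only [Set.mem_setOf_eq, mem_cylinder, Finset.mem_insert, Finset.mem_singleton,
      forall_eq_or_imp, forall_eq, hσ, if_true, if_neg h12.symm, if_neg h13.symm, if_neg h14.symm,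
      if_neg h15.symm, if_neg h23.symm, if_neg h24.symm, if_neg h25.symm, if_neg h34.symm,
      if_neg h35.symm, if_neg h45.symm]
  rw [hset, prob_cylinder]
  have h1 : c₁ ∉ ({c₂, c₃, c₄, c₅} : Finset E) := by simp [h12, h13, h14, h15]
  have h2 : c₂ ∉ ({c₃, c₄, c₅} : Finset E) := by simp [h23, h24, h25]
  have h3 : c₃ ∉ ({c₄, c₅} : Finset E) := by simp [h34, h35]
  have h4 : c₄ ∉ ({c₅} : Finset E) := by simp [h45]
  rw [Finset.prod_insert h1, Finset.prod_insert h2, Finset.prod_insert h3, Finset.prod_insert h4,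
    Finset.prod_singleton]
  simp only [hσ, if_true, if_neg h12.symm, if_neg h13.symm, if_neg h14.symm, if_neg h15.symm,
    if_neg h23.symm, if_neg h24.symm, if_neg h25.symm, if_neg h34.symm, if_neg h35.symm,
    if_neg h45.symm]
  ring

end Cyl5

end Summit.Ventures.PercRepro2.Coin
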